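import Summits.ResolutionOfSingularities.ResolutionOfSingularities.Theorems.ExtinctionCutToric
import HarnessLib

/-!
# ExtinctionCutToric2 — decomp-res node «ExtinctionCut» (lens-3 g20, critic row 156), tree file 6/8 of the node

Content VERBATIM from the decomp-res lens-3 g20 node `HOME/decomp-res-lens-3/g20/ExtinctionCut.lean` (pin c917c20b =
`parts/ExtinctionCut-g20-c917c20b.lean`, 1 323 l; HOME = run/shared/lean/pub/decomp-res; lens imports = tree
`MaxContactCutFreezeCut` +
`StallVertexStraightClasses` only; rc 0 · 0 sorry).  Critic: CRITIC-LEDGER row 156 (2026-08-31T00:18:27Z):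
DECIDED-MOD-PORT +1 — the BALANCED
BOUNDARY CLASS `FreezeCut.NoBalancedBoundaryTailsDeep` decided AS A WHOLE modulo ONE typed port
`ExtinctionCut.KollarWallPort`.  Landing orders
INBOX :552 (critic) and :467 / :489 (the lens-3 g19 rev-4 blocks §D / §K7 = `FreezeCutDead` + classes add-on, land
first), `--kind proof --supports
stmt-ResolutionOfSingularities-31770` (`MaxContactCut.DefectWalksDeep`).  Files of the node, in import order:
`FreezeCutDead` (§D, namespace
`…HoleCut.TailShade`, over the in-cone `MaxContactCutFreezeCut`) · `FreezeCutDeadClasses` (§K7 classes, cone-free,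
namespace `…FreezeCut`) ·
`MaxContactCutFreezeCutDead` (§K7 kernels and EXACT iff's at 31770, Theses cone) · `ExtinctionCutToric` /
`ExtinctionCutToric2` (§1, Mathlib only,
namespace `…ExtinctionCut`) · `ExtinctionCutPort` (§2, the ONE typed port `KollarWallPort`, cone-free so that the
route file can cite it as an item) ·
`MaxContactCutExtinctionCut` (§3 booking at 31770, Theses cone; §M `closes` = tree
`MaxContactCutExponentLadder.closes` verbatim is omitted, as in
`MaxContactCutFreezeCut`).  Aside bookkeeping (row 156 / INBOX :552): on the lens-3 column ONE typed PORT item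
`KollarWallPort` and ONE live aside
`FreezeCut.NoSmallDeadStrictHighSkewJointTailsDeep` (home `FreezeCutDeadClasses`) superseding the rev-4 sub-class
pair; decided cells are THEOREMS and
are not filed.

## This file

§1 continued (`section Toric`): `goodU` / `goodV` (after the first `U`, resp. `V`, the potential is `≤ n`),
**`extinction`** (every orbit from the box `[−n, ∞)²` with `−n ≤ a + b` along it enters `ℕ²` by the UNIFORM time
`max t_U t_V + n + 1`), **`witnessExtinction`** (the form consumed by §3), `both_letters_of_switches` (a letter
switch beyond every bound gives both letters beyond every bound).  Imports `ExtinctionCutToric`.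

[WRITER NOTE (decomp-res writer g9): file split only (tree files ≤ 400 lines); namespaces, sections, section
variables and every declaration
exactly as in the lens (the lens's global opens are replayed per file; cone-free files carry the opens of
`FreezeCutClasses.lean`, the toric kernel none).]

(Sources: Kollar2007 (Lectures on Resolution of Singularities: Thm 1.93, Def 2.56, Rem 2.57, Claim 2.59.1, (2.59.2),
Claim 2.59.4) [corpus:book:kollar2007-lectures-resolution-singularities pp. 54, 92–94]; Hauser2010Kangaroo
(arXiv:0811.4151); Moh1987; CossartPiltant2008 §2; CossartPiltant2019 Prop. 2.50; HauserPerlega2019 §1.)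
-/

noncomputable section

namespace Summit.ResolutionOfSingularities.ResolutionOfSingularities.Theorems.ExtinctionCut

section Toric

variable {w : ℕ → Bool} {x : ℤ × ℤ} {n : ℕ}

/-- After a `U`-step every point is absorbed, or of type `b < 0 < a`, or of type `a < 0 < b` with potential `≤ n`;
and this persists. [new] [folklore] -/
theorem goodU (hσ : ∀ t, -(n : ℤ) ≤ (orbit w x t).1 + (orbit w x t).2)
    (hU : ∀ M, ∃ t, M ≤ t ∧ w t = true) (hV : ∀ M, ∃ t, M ≤ t ∧ w t = false)
    (hx : -(n : ℤ) ≤ x.1 ∧ -(n : ℤ) ≤ x.2) {tU : ℕ} (htU : w tU = true) :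
    ∀ t, tU + 1 ≤ t → InQuad (orbit w x t) ∨ (0 < (orbit w x t).1 ∧ (orbit w x t).2 < 0) ∨
      ((orbit w x t).1 < 0 ∧ 0 < (orbit w x t).2 ∧ pot (orbit w x t) ≤ n) := by
  intro t ht
  induction t, ht using Nat.le_induction with
  | base =>
    have tri := trichotomy hσ hU hV tU
    have tri1 := trichotomy hσ hU hV (tU + 1)
    have hlb := lower_bounds hσ hx tU
    obtain ⟨e1, e2⟩ := orbit_succ_of_true (x := x) htU
    rcases tri with ⟨h1, h2⟩ | ⟨ha, hb⟩ | ⟨ha, hb⟩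
    · exact Or.inl ⟨by omega, by omega⟩
    · rcases tri1 with h | ⟨ha', hb'⟩ | ⟨ha', hb'⟩
      · exact Or.inl h
      · refine Or.inr (Or.inr ⟨ha', hb', ?_⟩)
        rw [pot_of_fst_neg ha' hb']
        omega
      · exfalso
        omega
    · rcases tri1 with h | ⟨ha', hb'⟩ | ⟨ha', hb'⟩
      · exact Or.inl h
      · exfalso
        omega
      · exact Or.inr (Or.inl ⟨ha', hb'⟩)
  | succ t ht ih =>
    have tri1 := trichotomy hσ hU hV (t + 1)
    rcases ih with h | ⟨ha, hb⟩ | ⟨ha, hb, hp⟩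
    · exact Or.inl (by rw [orbit_succ]; exact inQuad_step _ h)
    · rcases tri1 with h | ⟨ha', hb'⟩ | ⟨ha', hb'⟩
      · exact Or.inl h
      · exfalso
        cases hw : w t
        · obtain ⟨e1, e2⟩ := orbit_succ_of_false (x := x) hw
          omega
        · obtain ⟨e1, e2⟩ := orbit_succ_of_true (x := x) hw
          omega
      · exact Or.inr (Or.inl ⟨ha', hb'⟩)
    · rw [pot_of_fst_neg ha hb] at hp
      rcases tri1 with h | ⟨ha', hb'⟩ | ⟨ha', hb'⟩
      · exact Or.inl h
      · refine Or.inr (Or.inr ⟨ha', hb', ?_⟩)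
        rw [pot_of_fst_neg ha' hb']
        cases hw : w t
        · obtain ⟨e1, e2⟩ := orbit_succ_of_false (x := x) hw
          omega
        · obtain ⟨e1, e2⟩ := orbit_succ_of_true (x := x) hw
          omega
      · exfalso
        cases hw : w t
        · obtain ⟨e1, e2⟩ := orbit_succ_of_false (x := x) hw
          omega
        · obtain ⟨e1, e2⟩ := orbit_succ_of_true (x := x) hw
          omega

/-- Symmetric statement after a `V`-step. [new] [folklore] -/
theorem goodV (hσ : ∀ t, -(n : ℤ) ≤ (orbit w x t).1 + (orbit w x t).2)
    (hU : ∀ M, ∃ t, M ≤ t ∧ w t = true) (hV : ∀ M, ∃ t, M ≤ t ∧ w t = false)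
    (hx : -(n : ℤ) ≤ x.1 ∧ -(n : ℤ) ≤ x.2) {tV : ℕ} (htV : w tV = false) :
    ∀ t, tV + 1 ≤ t → InQuad (orbit w x t) ∨ ((orbit w x t).1 < 0 ∧ 0 < (orbit w x t).2) ∨
      (0 < (orbit w x t).1 ∧ (orbit w x t).2 < 0 ∧ pot (orbit w x t) ≤ n) := by
  intro t ht
  induction t, ht using Nat.le_induction with
  | base =>
    have tri := trichotomy hσ hU hV tV
    have tri1 := trichotomy hσ hU hV (tV + 1)
    have hlb := lower_bounds hσ hx tV
    obtain ⟨e1, e2⟩ := orbit_succ_of_false (x := x) htV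
    rcases tri with ⟨h1, h2⟩ | ⟨ha, hb⟩ | ⟨ha, hb⟩
    · exact Or.inl ⟨by omega, by omega⟩
    · rcases tri1 with h | ⟨ha', hb'⟩ | ⟨ha', hb'⟩
      · exact Or.inl h
      · exact Or.inr (Or.inl ⟨ha', hb'⟩)
      · exfalso
        omega
    · rcases tri1 with h | ⟨ha', hb'⟩ | ⟨ha', hb'⟩
      · exact Or.inl h
      · exfalso
        omega
      · refine Or.inr (Or.inr ⟨ha', hb', ?_⟩)
        rw [pot_of_snd_neg ha' hb']
        omega
  | succ t ht ih =>
    have tri1 := trichotomy hσ hU hV (t + 1)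
    rcases ih with h | ⟨ha, hb⟩ | ⟨ha, hb, hp⟩
    · exact Or.inl (by rw [orbit_succ]; exact inQuad_step _ h)
    · rcases tri1 with h | ⟨ha', hb'⟩ | ⟨ha', hb'⟩
      · exact Or.inl h
      · exact Or.inr (Or.inl ⟨ha', hb'⟩)
      · exfalso
        cases hw : w t
        · obtain ⟨e1, e2⟩ := orbit_succ_of_false (x := x) hw
          omega
        · obtain ⟨e1, e2⟩ := orbit_succ_of_true (x := x) hw
          omega
    · rw [pot_of_snd_neg ha hb] at hp
      rcases tri1 with h | ⟨ha', hb'⟩ | ⟨ha', hb'⟩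
      · exact Or.inl h
      · exfalso
        cases hw : w t
        · obtain ⟨e1, e2⟩ := orbit_succ_of_false (x := x) hw
          omega
        · obtain ⟨e1, e2⟩ := orbit_succ_of_true (x := x) hw
          omega
      · refine Or.inr (Or.inr ⟨ha', hb', ?_⟩)
        rw [pot_of_snd_neg ha' hb']
        cases hw : w t
        · obtain ⟨e1, e2⟩ := orbit_succ_of_false (x := x) hw
          omega
        · obtain ⟨e1, e2⟩ := orbit_succ_of_true (x := x) hw
          omega

/-- **THE EXTINCTION THEOREM (per point, uniform time).**  An equimultiple orbit of a skew word starting in the box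
`[−n, ∞)²` is absorbed in the quadrant from time `max t_U t_V + n + 1` on, for ANY `U`-time `t_U` and `V`-time `t_V`.
[new] [folklore] -/
theorem extinction (hσ : ∀ t, -(n : ℤ) ≤ (orbit w x t).1 + (orbit w x t).2)
    (hU : ∀ M, ∃ t, M ≤ t ∧ w t = true) (hV : ∀ M, ∃ t, M ≤ t ∧ w t = false)
    (hx : -(n : ℤ) ≤ x.1 ∧ -(n : ℤ) ≤ x.2) {tU tV : ℕ} (htU : w tU = true) (htV : w tV = false) :
    ∀ t, max tU tV + n + 1 ≤ t → InQuad (orbit w x t) := by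
  intro t ht
  obtain ⟨t₀, rfl⟩ : ∃ t₀, t = t₀ + n := ⟨t - n, by omega⟩
  have hm : max tU tV + 1 ≤ t₀ := by omega
  have h1 := goodU hσ hU hV hx htU t₀ ((Nat.add_le_add_right (le_max_left tU tV) 1).trans hm)
  have h2 := goodV hσ hU hV hx htV t₀ ((Nat.add_le_add_right (le_max_right tU tV) 1).trans hm)
  by_cases h0 : InQuad (orbit w x t₀)
  · exact inQuad_orbit_add h0 n
  apply inQuad_of_pot_le hσ hU hV n t₀
  rcases h1 with h | ⟨ha, hb⟩ | ⟨-, -, hp⟩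
  · exact absurd h h0
  · rcases h2 with h | ⟨ha', -⟩ | ⟨-, -, hp⟩
    · exact absurd h h0
    · exfalso
      omega
    · exact hp
  · exact hp

/-- **THE EXTINCTION THEOREM (set form used by the booking).**  For a skew word and any set `A` of seeds in the box
`[−n, ∞)²` all of whose orbits are equimultiple, there is ONE time from which every orbit is absorbed. [new] [folklore] -/
theorem witnessExtinction (n : ℕ) (w : ℕ → Bool)
    (hU : ∀ M, ∃ t, M ≤ t ∧ w t = true) (hV : ∀ M, ∃ t, M ≤ t ∧ w t = false) (A : Set (ℤ × ℤ))
    (hA : ∀ x ∈ A, -(n : ℤ) ≤ x.1 ∧ -(n : ℤ) ≤ x.2)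
    (hσ : ∀ x ∈ A, ∀ t, -(n : ℤ) ≤ (orbit w x t).1 + (orbit w x t).2) :
    ∃ T, ∀ x ∈ A, ∀ t, T ≤ t → InQuad (orbit w x t) := by
  obtain ⟨tU, -, htU⟩ := hU 0
  obtain ⟨tV, -, htV⟩ := hV 0
  exact ⟨max tU tV + n + 1, fun x hx t ht => extinction (hσ x hx) hU hV (hA x hx) htU htV t ht⟩

/-- A word that SWITCHES letter beyond every bound takes both values beyond every bound. [folklore] -/
theorem both_letters_of_switches (w : ℕ → Bool) (h : ∀ M, ∃ t, M ≤ t ∧ w (t + 1) ≠ w t) :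
    (∀ M, ∃ t, M ≤ t ∧ w t = true) ∧ (∀ M, ∃ t, M ≤ t ∧ w t = false) := by
  constructor
  · intro M
    obtain ⟨t, ht, hne⟩ := h M
    cases h1 : w t
    · refine ⟨t + 1, by omega, ?_⟩
      cases h2 : w (t + 1)
      · exact absurd (h2.trans h1.symm) hne
      · rfl
    · exact ⟨t, ht, h1⟩
  · intro M
    obtain ⟨t, ht, hne⟩ := h M
    cases h1 : w t
    · exact ⟨t, ht, h1⟩
    · refine ⟨t + 1, by omega, ?_⟩
      cases h2 : w (t + 1)
      · rfl
      · exact absurd (h2.trans h1.symm) hne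

end Toric

end Summit.ResolutionOfSingularities.ResolutionOfSingularities.Theorems.ExtinctionCut
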